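import Literature.NumberTheory.LFunctions.ClassGroupLFunctionStripBounds
import Literature.NumberTheory.LFunctions.EntireZeroSum
import Literature.NumberTheory.LFunctions.SmoothedExplicitFormulaCharContour
import Literature.NumberTheory.LFunctions.ClassGroupLogFreeLemmaB
import HarnessLib

/-!
# The smoothed explicit formula for the class group `L`-functions of a number field

Topic `Literature/NumberTheory/LFunctions`, namespace `Literature.NumberTheory.LFunctions.NumberField`.
Everything here is PROVED; the definitions (`coefFordK`, `cgEFIntegrand`, `cgEFRemainder`) are glue.

For a number field `K` (degree `n`), a class group character `χ ≠ 1`, an admissible smoothing `f`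
(`IsSmoothedEFTest f p p' p'' x₀`) with **`f(0) = 0`** (so that the Laplace transform
`F(z) = ∫₀^∞ f(u) e^{−zu} du` is entire and `F₀ = F`), and `−1/2 < Re s < 3/2`:

  `Σ_n Λ_χ(n) f(log n) n^{−s} = − Σ_ρ m(ρ) F(s − ρ) − m₀ F(s) + (1/2π) ∫_ℝ (−L'/L)(−1/2 + iy, χ) F(s + 1/2 − iy) dy`

(`coefFordK_eq_explicit`), `ρ` over the non-trivial zeros of `L(s, χ)` (`0 < β < 1`, absolutely
convergent), `m₀` the order of `L(s, χ)` at the trivial zero `s = 0` (the only possible zero of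
`L(s, χ)` in `−1/2 ≤ Re s ≤ 0`). This is the class-group analogue of the tree's
`ExplicitPsiChar.charFordK_eq_explicit` (Heath-Brown 1992 Lemma 5.1 / Ford 2002 Lemma 4.5) and the
exact form of Thorner–Zaman's Lemma 4.3 (contour shift to `Re s = −1/2`) for `H = P_K`, `χ ≠ 1`.
Inputs: the residue step `EntireEF.rectBoundaryIntegral_neg_logDeriv_mul_eq`, good heights and
window counts (`ClassGroupLFunctionWindows`), `L'/L` on the strip at good heights
(`ClassGroupLFunctionStripBounds`) and on `Re s = −1/2` (`ClassGroupLFunctionLogDerivLeft`), and the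
prime side by termwise Mellin inversion (`integral_cpow_neg_mul_fordLaplace₀_eq` of the tree) for a
general coefficient sequence `|a(n)| ≤ C Λ(n)` (`integral_LSeries_coef_mul_fordLaplace₀`).

## References

* J. Thorner, A. Zaman, ANT 13 (2019), Lemma 4.3. [ThornerZaman2019]
* D. R. Heath-Brown, PLMS 64 (1992), Lemma 5.1. [HeathBrown1992PLMS]
* K. Ford, *Zero-free regions for the Riemann zeta function* (2002), Lemma 4.5. [Ford2002Millennium]
-/

noncomputable section

open Complex Real MeasureTheory Set Filter Topology ArithmeticFunction
open scoped LSeries.notation NumberField nonZeroDivisors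

namespace Literature.NumberTheory.LFunctions.NumberField

open Literature.NumberTheory.LFunctions.EntireEF Literature.NumberTheory.LFunctions.LogFreeDensity
  Literature.NumberTheory.LFunctions.LogFreeLocal Literature.Analysis.Complex

/-! ## The prime side for a general coefficient sequence -/

section primeSide

variable {a : ℕ → ℂ} {C : ℝ} {f : ℝ → ℝ} {x₀ : ℝ} {s : ℂ} {α : ℝ}

/-- `K_{f,a}(s) = Σ_{n ≥ 1} a(n) f(log n) n^{−s}`. [cite: Ford2002Millennium, Lemma 4.5] -/
def coefFordK (a : ℕ → ℂ) (f : ℝ → ℝ) (s : ℂ) : ℂ :=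
  ∑' n : ℕ, a n * (f (Real.log n) : ℂ) * (n : ℂ) ^ (-s)

/-- If `f` vanishes on `[x₀, ∞)` and `x₀ ≤ log N` (`N ≥ 1`), `K_{f,a}(s)` is the finite sum over `n < N`. [folklore] -/
theorem coefFordK_eq_sum (a : ℕ → ℂ) {f : ℝ → ℝ} {x₀ : ℝ} (hf : ∀ u, x₀ ≤ u → f u = 0) {N : ℕ} (hN : 1 ≤ N)
    (hx : x₀ ≤ Real.log N) (s : ℂ) :
    coefFordK a f s = ∑ n ∈ Finset.range N, a n * (f (Real.log n) : ℂ) * (n : ℂ) ^ (-s) := by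
  rw [coefFordK, tsum_eq_sum]
  intro n hn
  rw [Finset.mem_range, not_lt] at hn
  have hlog : x₀ ≤ Real.log n := hx.trans (Real.log_le_log (by exact_mod_cast hN) (by exact_mod_cast hn))
  simp [hf _ hlog]

/-- `‖a(n) n^{-w}‖ ≤ C ‖Λ(n) n^{-Re w}‖` when `‖a n‖ ≤ C Λ(n)`. [folklore] -/
theorem norm_term_coef_le_re (ha : ∀ n, ‖a n‖ ≤ C * Λ n) (w : ℂ) (n : ℕ) :
    ‖LSeries.term a w n‖ ≤ C * ‖LSeries.term (fun n ↦ ((Λ n : ℝ) : ℂ)) (w.re : ℂ) n‖ := by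
  rcases Nat.eq_zero_or_pos n with rfl | hn
  · simp
  rw [LSeries.term_of_ne_zero hn.ne', LSeries.term_of_ne_zero hn.ne', norm_div, norm_div,
    Complex.norm_natCast_cpow_of_pos hn, Complex.norm_natCast_cpow_of_pos hn, Complex.ofReal_re, ← mul_div_assoc]
  refine div_le_div_of_nonneg_right ?_ (by positivity)
  rw [Complex.norm_real, Real.norm_of_nonneg vonMangoldt_nonneg]
  exact ha n

/-- `v ↦ L(a, α + iv)` is continuous (`α > 1`, `‖a n‖ ≤ C Λ(n)`). [folklore] -/
theorem continuous_LSeries_coef_vertical (ha : ∀ n, ‖a n‖ ≤ C * Λ n) (hα : 1 < α) :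
    Continuous fun v : ℝ ↦ L a (α + v * I) := by
  have hsum : Summable fun n ↦ C * ‖LSeries.term (fun n ↦ ((Λ n : ℝ) : ℂ)) (α : ℂ) n‖ :=
    (summable_norm_iff.mpr (ArithmeticFunction.LSeriesSummable_vonMangoldt (by simp [hα]))).mul_left C
  refine continuous_tsum (fun n ↦ ?_) hsum fun n v ↦ ?_
  · rcases Nat.eq_zero_or_pos n with rfl | hn
    · simp only [LSeries.term_zero]
      exact continuous_const
    · simp only [LSeries.term_of_ne_zero hn.ne']
      have hn0 : (n : ℂ) ≠ 0 := by exact_mod_cast hn.ne'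
      refine continuous_const.div ((by fun_prop : Continuous fun v : ℝ ↦ (α : ℂ) + v * I).const_cpow
        (Or.inl hn0)) fun v ↦ ?_
      exact cpow_ne_zero_iff.mpr (Or.inl hn0)
  · simpa using norm_term_coef_le_re ha ((α : ℂ) + v * I) n

/-- `‖L(a, α + iv)‖ ≤ C Σ ‖Λ(n) n^{−α}‖`. [folklore] -/
theorem norm_LSeries_coef_vertical_le (ha : ∀ n, ‖a n‖ ≤ C * Λ n) (hα : 1 < α) (v : ℝ) :
    ‖L a (α + v * I)‖ ≤ ∑' n, C * ‖LSeries.term (fun n ↦ ((Λ n : ℝ) : ℂ)) (α : ℂ) n‖ := by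
  have hsum : Summable fun n ↦ C * ‖LSeries.term (fun n ↦ ((Λ n : ℝ) : ℂ)) (α : ℂ) n‖ :=
    (summable_norm_iff.mpr (ArithmeticFunction.LSeriesSummable_vonMangoldt (by simp [hα]))).mul_left C
  have hle : ∀ n, ‖LSeries.term a (α + v * I) n‖ ≤ C * ‖LSeries.term (fun n ↦ ((Λ n : ℝ) : ℂ)) (α : ℂ) n‖ :=
    fun n ↦ by simpa using norm_term_coef_le_re ha ((α : ℂ) + v * I) n
  have hsum' : Summable fun n ↦ ‖LSeries.term a (α + v * I) n‖ :=
    Summable.of_nonneg_of_le (fun _ ↦ norm_nonneg _) hle hsum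
  exact (norm_tsum_le_tsum_norm hsum').trans (Summable.tsum_le_tsum hle hsum' hsum)

/-- The integrand `v ↦ L(a, α + iv) F₀(s − α − iv)` of the prime side is integrable. [folklore] -/
theorem integrable_LSeries_coef_mul_fordLaplace₀ (ha : ∀ n, ‖a n‖ ≤ C * Λ n) (hα : 1 < α)
    (hint : Integrable fun y : ℝ ↦ fordLaplace₀ f ((s.re - α : ℝ) + y * I)) :
    Integrable fun v : ℝ ↦ L a (α + v * I) * fordLaplace₀ f (s - (α + v * I)) :=
  (integrable_fordLaplace₀_sub hint).bdd_mul (continuous_LSeries_coef_vertical ha hα).aestronglyMeasurable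
    (ae_of_all _ (norm_LSeries_coef_vertical_le ha hα))

/-- The `n`-th term is integrable. [folklore] -/
theorem integrable_term_coef_mul_fordLaplace₀ (hF : Integrable fun v : ℝ ↦ fordLaplace₀ f (s - (α + v * I))) (n : ℕ) :
    Integrable fun v : ℝ ↦ LSeries.term a (α + v * I) n * fordLaplace₀ f (s - (α + v * I)) := by
  rcases Nat.eq_zero_or_pos n with rfl | hn
  · simp only [LSeries.term_zero, zero_mul]
    exact integrable_zero _ _ _
  have hn0 : (n : ℂ) ≠ 0 := by exact_mod_cast hn.ne'
  have hcont : Continuous fun v : ℝ ↦ (n : ℂ) ^ (-((α : ℂ) + v * I)) :=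
    (by fun_prop : Continuous fun v : ℝ ↦ -((α : ℂ) + v * I)).const_cpow (Or.inl hn0)
  have hbdd : ∀ v : ℝ, ‖(n : ℂ) ^ (-((α : ℂ) + v * I))‖ ≤ (n : ℝ) ^ (-α) := by
    intro v
    rw [norm_natCast_cpow_of_pos hn]
    simp
  have h := (hF.bdd_mul hcont.aestronglyMeasurable (ae_of_all _ hbdd)).const_mul (a n)
  refine h.congr (Eventually.of_forall fun v ↦ ?_)
  simp only [LSeries.term_of_ne_zero hn.ne', div_eq_mul_inv, ← cpow_neg]
  ring

/-- **The prime side**: for `f` continuous vanishing on `[x₀, ∞)`, `1 < α`, `Re s < α`, `F₀` integrable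
on `Re u = Re s − α` and `‖a n‖ ≤ C Λ(n)`:
`∫_ℝ L(a, α + iv) F₀(s − α − iv) dv = 2π K_{f,a}(s)` (termwise, by Mellin inversion).
[cite: HeathBrown1992PLMS, Lemma 5.1 (proof)] -/
theorem integral_LSeries_coef_mul_fordLaplace₀ (ha : ∀ n, ‖a n‖ ≤ C * Λ n) (hfc : Continuous f)
    (hf0 : ∀ u, x₀ ≤ u → f u = 0) (hα : 1 < α) (hσ : s.re < α)
    (hint : Integrable fun y : ℝ ↦ fordLaplace₀ f ((s.re - α : ℝ) + y * I)) :
    ∫ v : ℝ, L a (α + v * I) * fordLaplace₀ f (s - (α + v * I)) = 2 * π * coefFordK a f s := by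
  have hf1 : ∀ u, max x₀ 0 ≤ u → f u = 0 := fun u hu ↦ hf0 u ((le_max_left _ _).trans hu)
  have hx₁ : 0 ≤ max x₀ 0 := le_max_right _ _
  have hF := integrable_fordLaplace₀_sub hint
  set Fn : ℕ → ℝ → ℂ := fun n v ↦ LSeries.term a (α + v * I) n * fordLaplace₀ f (s - (α + v * I)) with hFn
  have hF_int : ∀ n, Integrable (Fn n) := integrable_term_coef_mul_fordLaplace₀ hF
  have hsumα : Summable fun n ↦ C * ‖LSeries.term (fun n ↦ ((Λ n : ℝ) : ℂ)) (α : ℂ) n‖ :=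
    (summable_norm_iff.mpr (ArithmeticFunction.LSeriesSummable_vonMangoldt (by simp [hα]))).mul_left C
  have hF_sum : Summable fun n ↦ ∫ v, ‖Fn n v‖ := by
    refine Summable.of_nonneg_of_le (fun n ↦ integral_nonneg fun v ↦ norm_nonneg _) (fun n ↦ ?_)
      (hsumα.mul_right (∫ v : ℝ, ‖fordLaplace₀ f (s - (α + v * I))‖))
    have hle : ∀ v, ‖Fn n v‖ ≤ C * ‖LSeries.term (fun n ↦ ((Λ n : ℝ) : ℂ)) (α : ℂ) n‖ * ‖fordLaplace₀ f (s - (α + v * I))‖ := by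
      intro v
      rw [hFn, norm_mul]
      refine mul_le_mul_of_nonneg_right ?_ (norm_nonneg _)
      simpa using norm_term_coef_le_re ha ((α : ℂ) + v * I) n
    calc ∫ v : ℝ, ‖Fn n v‖ ≤ ∫ v : ℝ, C * ‖LSeries.term (fun n ↦ ((Λ n : ℝ) : ℂ)) (α : ℂ) n‖ * ‖fordLaplace₀ f (s - (α + v * I))‖ :=
          integral_mono (hF_int n).norm (hF.norm.const_mul _) hle
      _ = C * ‖LSeries.term (fun n ↦ ((Λ n : ℝ) : ℂ)) (α : ℂ) n‖ * ∫ v : ℝ, ‖fordLaplace₀ f (s - (α + v * I))‖ :=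
          integral_const_mul _ _
  have hterm : ∀ n, ∫ v, Fn n v = a n * (2 * π * (f (Real.log n) : ℂ) * (n : ℂ) ^ (-s)) := by
    intro n
    rcases Nat.eq_zero_or_pos n with rfl | hn
    · have h0 : Fn 0 = fun _ ↦ 0 := by
        funext v
        simp only [hFn, LSeries.term_zero, zero_mul]
      have ha0 : a 0 = 0 := by
        have := ha 0
        rw [ArithmeticFunction.map_zero, mul_zero] at this
        exact norm_le_zero_iff.1 this
      rw [h0, integral_zero, ha0, zero_mul]
    · have h := integral_cpow_neg_mul_fordLaplace₀_eq hfc hf1 hx₁ hσ hint (Nat.one_le_of_lt hn)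
      have h' : Fn n = fun v : ℝ ↦ a n * ((n : ℂ) ^ (-((α : ℂ) + v * I)) * fordLaplace₀ f (s - (α + v * I))) := by
        funext v
        simp only [hFn, LSeries.term_of_ne_zero hn.ne', div_eq_mul_inv, ← cpow_neg]
        ring
      rw [h', integral_const_mul, h]
  calc ∫ v : ℝ, L a (α + v * I) * fordLaplace₀ f (s - (α + v * I))
      = ∫ v, ∑' n, Fn n v := by
        refine integral_congr_ae (ae_of_all _ fun v ↦ ?_)
        simp only [hFn, LSeries, tsum_mul_right]
    _ = ∑' n, ∫ v, Fn n v := (integral_tsum_of_summable_integral_norm hF_int hF_sum).symm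
    _ = ∑' n, a n * (2 * π * (f (Real.log n) : ℂ) * (n : ℂ) ^ (-s)) := tsum_congr hterm
    _ = 2 * π * coefFordK a f s := by
        rw [coefFordK, ← tsum_mul_left]
        refine tsum_congr fun n ↦ ?_
        ring

end primeSide

/-! ## The coefficients `Λ_χ`, the integrand, and `F₀ = F` for `f(0) = 0` -/

variable {K : Type} [Field K] [NumberField K]

/-- `Λ_χ(n) = Σ_{N𝔫 = n} Λ(𝔫)χ(𝔫)` as a function on `ℕ`. [cite: ThornerZaman2019, (2.2)] -/
abbrev cgCoef (χ : ClassGroup (𝓞 K) →* ℂˣ) : ℕ → ℂ := twistVonMangoldt K (classGroupCharIdealHom χ)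

/-- `‖Λ_χ(n)‖ ≤ n_K Λ(n)`. [folklore] -/
theorem norm_cgCoef_le (χ : ClassGroup (𝓞 K) →* ℂˣ) (n : ℕ) : ‖cgCoef χ n‖ ≤ Module.finrank ℚ K * Λ n :=
  (norm_twistVonMangoldt_le (norm_classGroupCharIdealHom_le χ) n).trans (vonMangoldtNorm_le_finrank_mul n)

omit [NumberField K] in
/-- For `f(0) = 0`: `F₀ = F`. [folklore] -/
theorem fordLaplace₀_eq_fordLaplace {f : ℝ → ℝ} (hf : f 0 = 0) (z : ℂ) : fordLaplace₀ f z = fordLaplace f z := by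
  simp [fordLaplace₀, hf]

/-- The integrand `G(w) = (−L₀'/L₀)(w, χ) · F(s − w)`. [cite: ThornerZaman2019, Lemma 4.3 (proof)] -/
def cgEFIntegrand (χ : ClassGroup (𝓞 K) →* ℂˣ) (f : ℝ → ℝ) (s w : ℂ) : ℂ :=
  -logDeriv (classGroupLFunction₀ K χ) w * fordLaplace₀ f (s - w)

/-- The left-line integral `J_χ(s) = (1/2π) ∫_ℝ G(−1/2 + iy) dy`. [cite: ThornerZaman2019, Lemma 4.3] -/
def cgEFRemainder (χ : ClassGroup (𝓞 K) →* ℂˣ) (f : ℝ → ℝ) (s : ℂ) : ℂ :=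
  (1 / (2 * π) : ℂ) * ∫ y : ℝ, cgEFIntegrand χ f s (((-(1 / 2) : ℝ) : ℂ) + y * I)

/-! ## The zeros of `L₀(·, χ)` in `−1/2 ≤ Re w ≤ 3/2` -/

omit [NumberField K] in
/-- `χ⁻¹ ≠ 1` for `χ ≠ 1`. [folklore] -/
theorem inv_ne_one_of_ne_one {χ : ClassGroup (𝓞 K) →* ℂˣ} (hχ : χ ≠ 1) : χ⁻¹ ≠ 1 := fun h ↦ hχ (by
  ext C
  have := congrArg (fun ψ : ClassGroup (𝓞 K) →* ℂˣ ↦ ((ψ C)⁻¹ : ℂˣ)) h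
  simpa using this)

/-- **The zeros of `L₀(·, χ)` with `Re w ≤ 3/2`** (`χ ≠ 1`): either non-trivial (`0 < Re w < 1`) or the
integer `w = 0` — when in addition `−1/2 ≤ Re w`; more generally every zero with `Re w ≤ 0` is an
integer (reflection + non-vanishing on `Re ≥ 1`). [cite: MontgomeryVaughan2007, Corollary 10.8 (analogue)] -/
theorem zero_classGroupLFunction₀_cases {χ : ClassGroup (𝓞 K) →* ℂˣ} (hχ : χ ≠ 1) {w : ℂ}
    (h0 : classGroupLFunction₀ K χ w = 0) (hre1 : -(1 / 2) ≤ w.re) (hre2 : w.re ≤ 3 / 2) :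
    (0 < w.re ∧ w.re < 1) ∨ w = 0 := by
  have hχ' := inv_ne_one_of_ne_one hχ
  by_cases hZ : ∃ n : ℤ, w = n
  · obtain ⟨n, rfl⟩ := hZ
    right
    have h1 : (n : ℂ).re = n := by simp
    rw [h1] at hre1 hre2
    have hn0 : -1 < n := by
      have : (-1 : ℝ) < n := by linarith
      exact_mod_cast this
    have hn1 : n < 2 := by
      have : (n : ℝ) < 2 := by linarith
      exact_mod_cast this
    interval_cases n
    · simp
    · exfalso; exact classGroupLFunction₀_ne_zero_of_one_le_re hχ (by simp) h0
  · push Not at hZ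
    left
    have hwZ : ∀ n : ℤ, w ≠ n := fun n h ↦ hZ n h
    have hw1 : w ≠ 1 := fun h ↦ hwZ 1 (by rw [h]; simp)
    have hlt1 : w.re < 1 := by
      by_contra hge; rw [not_lt] at hge
      exact classGroupLFunction₀_ne_zero_of_one_le_re hχ hge h0
    refine ⟨?_, hlt1⟩
    by_contra hle; rw [not_lt] at hle
    -- `Re w ≤ 0`: reflect
    have h1w1 : 1 - w ≠ 1 := fun h ↦ hwZ 0 (by simp at h ⊢; exact h)
    have hL' : classGroupLFunction K χ⁻¹ (1 - w) ≠ 0 := by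
      rw [← classGroupLFunction₀_eq χ⁻¹ h1w1 hχ']
      exact classGroupLFunction₀_ne_zero_of_one_le_re hχ' (by simp; linarith)
    have hLw := (logDeriv_classGroupLFunction_reflect χ hwZ hL').1
    rw [← classGroupLFunction₀_eq χ hw1 hχ] at hLw
    exact hLw h0

/-- At a height `T` avoided by the ordinates of the non-trivial zeros, no zero of `L₀(·, χ)` lies on the
boundary of `[−1/2, 3/2] × [−T, T]` (`T > 0`). [folklore] -/
theorem rect_boundary_free {χ : ClassGroup (𝓞 K) →* ℂˣ} (hχ : χ ≠ 1) {T : ℝ} (hT : 0 < T)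
    (hgood : ∀ ρ : ℂ, classGroupLFunction₀ K χ ρ = 0 → 0 < ρ.re → ρ.re < 1 → ρ.im ≠ T ∧ ρ.im ≠ -T) :
    ∀ ρ : ℂ, classGroupLFunction₀ K χ ρ = 0 → ρ.re ∈ Icc (-(1 / 2) : ℝ) (3 / 2) → ρ.im ∈ Icc (-T) T →
      ρ.re ∈ Ioo (-(1 / 2) : ℝ) (3 / 2) ∧ ρ.im ∈ Ioo (-T) T := by
  intro ρ h0 hre him
  rcases zero_classGroupLFunction₀_cases hχ h0 hre.1 hre.2 with ⟨h1, h2⟩ | rfl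
  · obtain ⟨ha, hb⟩ := hgood ρ h0 h1 h2
    refine ⟨⟨by linarith, by linarith⟩, ?_⟩
    exact ⟨lt_of_le_of_ne him.1 (Ne.symm hb), lt_of_le_of_ne him.2 ha⟩
  · simp only [Complex.zero_re, Complex.zero_im, mem_Ioo]
    exact ⟨⟨by norm_num, by norm_num⟩, ⟨by linarith, hT⟩⟩

/-! ## The contour identity at a good height -/

/-- **The contour identity**: `χ ≠ 1`, `f` continuous vanishing on `[x₀, ∞)` with `f(0) = 0`, `T > 0`
a good height. Then `∮_{∂([−1/2,3/2]×[−T,T])} G = 2πi Σ_{ρ ∈ rect, L₀(ρ)=0} (−m(ρ)) F(s − ρ)`.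
[cite: HeathBrown1992PLMS, Lemma 5.1 (proof, (5.6)–(5.7))] -/
theorem cgEF_contour_identity {χ : ClassGroup (𝓞 K) →* ℂˣ} (hχ : χ ≠ 1) {f : ℝ → ℝ} {x₀ : ℝ}
    (hfc : Continuous f) (hx₀ : 0 ≤ x₀) (hf0 : ∀ u, x₀ ≤ u → f u = 0) (hf00 : f 0 = 0) (s : ℂ) {T : ℝ} (hT : 0 < T)
    (hgood : ∀ ρ : ℂ, classGroupLFunction₀ K χ ρ = 0 → 0 < ρ.re → ρ.re < 1 → ρ.im ≠ T ∧ ρ.im ≠ -T) :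
    rectBoundaryIntegral (cgEFIntegrand χ f s) (-(1 / 2)) (3 / 2) (-T) T =
      2 * π * I * ∑ ρ ∈ rectZeros (differentiable_classGroupLFunction₀ χ) (classGroupLFunction₀_two_add_ne_zero hχ 0)
        (-(1 / 2)) (3 / 2) T, (-(analyticOrderNatAt (classGroupLFunction₀ K χ) ρ : ℂ) * fordLaplace₀ f (s - ρ)) := by
  have hΦ : Differentiable ℂ fun w ↦ fordLaplace₀ f (s - w) := by
    have hF := differentiable_fordLaplace hfc hx₀ hf0
    intro w
    have : (fun w ↦ fordLaplace₀ f (s - w)) = fun w ↦ fordLaplace f (s - w) := by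
      funext w; exact fordLaplace₀_eq_fordLaplace hf00 _
    rw [this]
    exact (hF (s - w)).comp w ((differentiableAt_const _).sub differentiableAt_id)
  have h := rectBoundaryIntegral_neg_logDeriv_mul_eq (differentiable_classGroupLFunction₀ χ)
    (classGroupLFunction₀_two_add_ne_zero hχ 0) hΦ (a := -(1 / 2)) (b := 3 / 2) (by norm_num) hT
    (rect_boundary_free hχ hT hgood)
  have heq : cgEFIntegrand χ f s = fun w ↦ -logDeriv (classGroupLFunction₀ K χ) w * fordLaplace₀ f (s - w) := by
    funext w; rw [cgEFIntegrand]
  rw [heq, h]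


/-! ## Absolute convergence of the zero sum -/

/-- The non-trivial zeros stay at a positive distance from a point `s` that is not one of them. [folklore] -/
theorem exists_dist_cgZeros_ge {χ : ClassGroup (𝓞 K) →* ℂˣ} (hχ : χ ≠ 1) {s : ℂ}
    (hsz : ∀ ρ : ℂ, classGroupLFunction₀ K χ ρ = 0 → 0 < ρ.re → ρ.re < 1 → ρ ≠ s) :
    ∃ d : ℝ, 0 < d ∧ d ≤ 1 ∧ ∀ ρ ∈ nontrivialZeros (classGroupLFunction₀ K χ), d ≤ ‖s - ρ‖ := by
  classical
  have hfin := finite_zeroBox_classGroupLFunction₀ hχ (|s.im| + 1)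
  set A : Finset ℝ := insert 1 (hfin.toFinset.image fun ρ ↦ ‖s - ρ‖) with hA
  have hne : A.Nonempty := ⟨1, Finset.mem_insert_self _ _⟩
  have hpos : ∀ a ∈ A, 0 < a := by
    intro a ha
    rw [hA, Finset.mem_insert, Finset.mem_image] at ha
    rcases ha with rfl | ⟨ρ, hρ, rfl⟩
    · exact one_pos
    · rw [Set.Finite.mem_toFinset] at hρ
      exact norm_pos_iff.2 (sub_ne_zero.2 (Ne.symm (hsz ρ hρ.1 hρ.2.1 hρ.2.2.1)))
  refine ⟨A.min' hne, hpos _ (Finset.min'_mem _ _), Finset.min'_le _ _ (Finset.mem_insert_self _ _), fun ρ hρ ↦ ?_⟩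
  by_cases hγ : |ρ.im| ≤ |s.im| + 1
  · refine Finset.min'_le _ _ ?_
    rw [hA, Finset.mem_insert, Finset.mem_image]
    refine Or.inr ⟨ρ, ?_, rfl⟩
    rw [Set.Finite.mem_toFinset]
    exact ⟨hρ.1, hρ.2.1, hρ.2.2, hγ⟩
  · push Not at hγ
    have h1 : (1 : ℝ) ≤ ‖s - ρ‖ := by
      have := Complex.abs_im_le_norm (s - ρ)
      rw [sub_im] at this
      have h2 : |ρ.im| - |s.im| ≤ |s.im - ρ.im| := by
        have := abs_sub_abs_le_abs_sub ρ.im s.im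
        rwa [abs_sub_comm] at this
      linarith
    exact (Finset.min'_le _ _ (Finset.mem_insert_self _ _)).trans h1

/-- The window bound in the abstract form: `Σ_{window} m ≤ 512(n_K+1)(A + log(|τ| + 4))`, `A = log|d_K| + 3n_K`. [folklore] -/
theorem window_bound_classGroupLFunction₀ {χ : ClassGroup (𝓞 K) →* ℂˣ} (hχ : χ ≠ 1) (τ : ℝ) (P : Finset ℂ)
    (hP : ∀ ρ ∈ P, classGroupLFunction₀ K χ ρ = 0 ∧ 0 < ρ.re ∧ ρ.re < 1 ∧ |ρ.im - τ| ≤ 1 / 2) :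
    ∑ ρ ∈ P, (analyticOrderNatAt (classGroupLFunction₀ K χ) ρ : ℝ) ≤
      (512 * (Module.finrank ℚ K + 1)) * ((Real.log ((NumberField.discr K).natAbs : ℝ) + 3 * Module.finrank ℚ K) + Real.log (|τ| + 4)) := by
  have h := sum_window_classGroupLFunction₀_le hχ τ P hP
  simp only [zeroOrder] at h
  refine h.trans ?_
  rw [discBound]
  have hl := log_abs_add_seven_le τ
  have hd : 0 ≤ Real.log ((NumberField.discr K).natAbs : ℝ) := Real.log_natCast_nonneg _
  have hn : (0 : ℝ) ≤ Module.finrank ℚ K := Nat.cast_nonneg _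
  have hl4 : 0 ≤ Real.log (|τ| + 4) := Real.log_nonneg (by linarith [abs_nonneg τ])
  have hl7 : 0 ≤ Real.log (|τ| + 7) := Real.log_nonneg (by linarith [abs_nonneg τ])
  nlinarith [mul_nonneg hn hl4, mul_nonneg hn hl7, mul_le_mul_of_nonneg_left hl hn]

/-- **Absolute convergence of the zero sum** `Σ_ρ m(ρ) F(s − ρ)` (`χ ≠ 1`, admissible `f` with `f(0) = 0`,
`Re s > −1`, `s` not a non-trivial zero). [cite: HeathBrown1992PLMS, Lemma 5.1] -/
theorem summable_norm_cgZeroTerm {χ : ClassGroup (𝓞 K) →* ℂˣ} (hχ : χ ≠ 1) {f p p' p'' : ℝ → ℝ} {x₀ : ℝ}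
    (h : IsSmoothedEFTest f p p' p'' x₀) {s : ℂ} (hσ₁ : -1 < s.re)
    (hsz : ∀ ρ : ℂ, classGroupLFunction₀ K χ ρ = 0 → 0 < ρ.re → ρ.re < 1 → ρ ≠ s) :
    Summable fun ρ : nontrivialZeros (classGroupLFunction₀ K χ) ↦
      ‖(analyticOrderNatAt (classGroupLFunction₀ K χ) (ρ : ℂ) : ℂ) * fordLaplace₀ f (s - ρ)‖ := by
  obtain ⟨d, hd0, hd1, hd⟩ := exists_dist_cgZeros_ge hχ hsz
  set D := SmoothedEF.decayConst p' p'' x₀ with hD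
  have hD0 : 0 ≤ D := SmoothedEF.decayConst_nonneg h.x₀_nonneg
  set C : ℝ := (1 + 2 * s.im ^ 2) / d ^ 2 + 2 with hC
  have hA0 : 0 ≤ Real.log ((NumberField.discr K).natAbs : ℝ) + 3 * Module.finrank ℚ K := by
    have : 0 ≤ Real.log ((NumberField.discr K).natAbs : ℝ) := Real.log_natCast_nonneg _
    positivity
  refine summable_of_norm_le_mul_div (by positivity) hA0 (window_bound_classGroupLFunction₀ hχ) (B := D * C) fun ρ ↦ ?_
  have hm : (0 : ℝ) ≤ analyticOrderNatAt (classGroupLFunction₀ K χ) (ρ : ℂ) := Nat.cast_nonneg _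
  have hρ := ρ.2
  have hre0 := hρ.2.1
  have hre1 := hρ.2.2
  have hdρ := hd _ hρ
  have hne : s - (ρ : ℂ) ≠ 0 := norm_pos_iff.1 (hd0.trans_le hdρ)
  have hF := SmoothedEF.norm_fordLaplace₀_le h hne (by rw [sub_re]; linarith)
  rw [norm_mul, Complex.norm_natCast]
  have hd2 : d ^ 2 ≤ ‖s - ρ‖ ^ 2 := by nlinarith [norm_nonneg (s - (ρ : ℂ))]
  have hkey : 1 + (ρ : ℂ).im ^ 2 ≤ C * ‖s - ρ‖ ^ 2 := by
    have hn2 : (s.im - (ρ : ℂ).im) ^ 2 ≤ ‖s - ρ‖ ^ 2 := by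
      have := Complex.abs_im_le_norm (s - ρ)
      rw [sub_im] at this
      nlinarith [abs_nonneg (s.im - (ρ : ℂ).im), sq_abs (s.im - (ρ : ℂ).im)]
    have h1 : (ρ : ℂ).im ^ 2 ≤ 2 * (s.im - (ρ : ℂ).im) ^ 2 + 2 * s.im ^ 2 := by
      nlinarith [sq_nonneg (s.im - 2 * (ρ : ℂ).im), sq_nonneg ((ρ : ℂ).im - 2 * s.im), sq_nonneg (2 * s.im - (ρ : ℂ).im)]
    have h2 : 1 + 2 * s.im ^ 2 ≤ (1 + 2 * s.im ^ 2) / d ^ 2 * ‖s - ρ‖ ^ 2 := by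
      rw [div_mul_eq_mul_div, le_div_iff₀ (by positivity)]
      exact mul_le_mul_of_nonneg_left hd2 (by positivity)
    calc 1 + (ρ : ℂ).im ^ 2 ≤ (1 + 2 * s.im ^ 2) + 2 * (s.im - (ρ : ℂ).im) ^ 2 := by linarith
      _ ≤ (1 + 2 * s.im ^ 2) / d ^ 2 * ‖s - ρ‖ ^ 2 + 2 * ‖s - ρ‖ ^ 2 := by linarith
      _ = C * ‖s - ρ‖ ^ 2 := by rw [hC]; ring
  have hpos : 0 < ‖s - (ρ : ℂ)‖ ^ 2 := by positivity
  calc (analyticOrderNatAt (classGroupLFunction₀ K χ) (ρ : ℂ) : ℝ) * ‖fordLaplace₀ f (s - ρ)‖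
      ≤ (analyticOrderNatAt (classGroupLFunction₀ K χ) (ρ : ℂ) : ℝ) * (D / ‖s - ρ‖ ^ 2) := mul_le_mul_of_nonneg_left hF hm
    _ ≤ (analyticOrderNatAt (classGroupLFunction₀ K χ) (ρ : ℂ) : ℝ) * (D * C / (1 + (ρ : ℂ).im ^ 2)) := by
        refine mul_le_mul_of_nonneg_left ?_ hm
        rw [div_le_div_iff₀ hpos (by positivity)]
        calc D * (1 + (ρ : ℂ).im ^ 2) ≤ D * (C * ‖s - ρ‖ ^ 2) := mul_le_mul_of_nonneg_left hkey hD0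
          _ = D * C * ‖s - ρ‖ ^ 2 := by ring
    _ = D * C * ((analyticOrderNatAt (classGroupLFunction₀ K χ) (ρ : ℂ) : ℝ) / (1 + (ρ : ℂ).im ^ 2)) := by ring

/-! ## The left line `Re w = −1/2` -/

/-- `L₀(·, χ) ≠ 0` on `Re w = −1/2`, and `logDeriv L₀ = logDeriv L` there. [folklore] -/
theorem classGroupLFunction₀_leftLine_ne_zero {χ : ClassGroup (𝓞 K) →* ℂˣ} (hχ : χ ≠ 1) (y : ℝ) :
    classGroupLFunction₀ K χ (((-(1 / 2) : ℝ) : ℂ) + y * I) ≠ 0 ∧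
      logDeriv (classGroupLFunction₀ K χ) (((-(1 / 2) : ℝ) : ℂ) + y * I) =
        logDeriv (classGroupLFunction K χ) (-1 / 2 + y * I) := by
  have hχ' := inv_ne_one_of_ne_one hχ
  set w : ℂ := ((-(1 / 2) : ℝ) : ℂ) + y * I with hw
  have hwre : w.re = -1 / 2 := by simp [hw]; norm_num
  have hwZ : ∀ n : ℤ, w ≠ n := fun n h ↦ by
    have := congrArg Complex.re h
    rw [hwre] at this; simp at this
    have h2 : (2 * n : ℝ) = -1 := by linarith
    have h3 : (2 * n : ℤ) = -1 := by exact_mod_cast h2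
    omega
  have hw1 : w ≠ 1 := fun h ↦ hwZ 1 (by rw [h]; simp)
  have h1w1 : 1 - w ≠ 1 := fun h ↦ hwZ 0 (by simp at h ⊢; exact h)
  have hL' : classGroupLFunction K χ⁻¹ (1 - w) ≠ 0 := by
    rw [← classGroupLFunction₀_eq χ⁻¹ h1w1 hχ']
    exact classGroupLFunction₀_ne_zero_of_one_le_re hχ' (by simp [hwre]; norm_num)
  have hLw := (logDeriv_classGroupLFunction_reflect χ hwZ hL').1
  have hw' : w = -1 / 2 + y * I := by rw [hw]; push_cast; ring
  refine ⟨by rw [classGroupLFunction₀_eq χ hw1 hχ]; exact hLw, ?_⟩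
  rw [logDeriv_classGroupLFunction₀_eq_logDeriv hχ hw1, hw']

/-- The integrand `y ↦ G(−1/2 + iy)` is continuous (`χ ≠ 1`, `Re s > −1/2`, `f(0) = 0`). [folklore] -/
theorem continuous_cgIntegrand_left {χ : ClassGroup (𝓞 K) →* ℂˣ} (hχ : χ ≠ 1) {f : ℝ → ℝ} {x₀ : ℝ}
    (hfc : Continuous f) (hx₀ : 0 ≤ x₀) (hf0 : ∀ u, x₀ ≤ u → f u = 0) (hf00 : f 0 = 0) (s : ℂ) :
    Continuous fun y : ℝ ↦ cgEFIntegrand χ f s (((-(1 / 2) : ℝ) : ℂ) + y * I) := by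
  set Lv : ℝ → ℂ := fun y : ℝ ↦ (((-(1 / 2) : ℝ) : ℂ) + y * I) with hLv
  have hline : Continuous Lv := by rw [hLv]; fun_prop
  have hcomp : (fun y : ℝ ↦ cgEFIntegrand χ f s (((-(1 / 2) : ℝ) : ℂ) + y * I)) =
      (fun w ↦ -logDeriv (classGroupLFunction₀ K χ) w * fordLaplace₀ f (s - w)) ∘ Lv := rfl
  rw [hcomp]
  refine continuous_iff_continuousAt.2 fun y ↦ ContinuousAt.comp (x := y) ?_ hline.continuousAt
  have hL : classGroupLFunction₀ K χ (Lv y) ≠ 0 := (classGroupLFunction₀_leftLine_ne_zero hχ y).1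
  have han : AnalyticAt ℂ (classGroupLFunction₀ K χ) (Lv y) := (differentiable_classGroupLFunction₀ χ).analyticAt _
  have hF := differentiable_fordLaplace hfc hx₀ hf0
  have hΦ : ContinuousAt (fun w ↦ fordLaplace₀ f (s - w)) (Lv y) := by
    have : (fun w ↦ fordLaplace₀ f (s - w)) = fun w ↦ fordLaplace f (s - w) := by
      funext w; exact fordLaplace₀_eq_fordLaplace hf00 _
    rw [this]
    exact ((hF (s - Lv y)).comp (Lv y) ((differentiableAt_const _).sub differentiableAt_id)).continuousAt
  have hld : ContinuousAt (logDeriv (classGroupLFunction₀ K χ)) (Lv y) := by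
    have h1 : ContinuousAt (fun z ↦ deriv (classGroupLFunction₀ K χ) z / classGroupLFunction₀ K χ z) (Lv y) :=
      han.deriv.continuousAt.div han.continuousAt hL
    have h2 : logDeriv (classGroupLFunction₀ K χ) = fun z ↦ deriv (classGroupLFunction₀ K χ) z / classGroupLFunction₀ K χ z := by
      funext z; rw [logDeriv_apply]
    rw [h2]; exact h1
  exact hld.neg.mul hΦ

/-- **The left-line integrand is integrable on `ℝ`** (`χ ≠ 1`, `Re s > −1/2`):
`|L'/L(−1/2 + iy)| ≪ log|d_K| + log(|y| + 4)` against `|F| ≤ D/((σ + 1/2)² + (t − y)²)`. [folklore] -/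
theorem integrable_cgIntegrand_left {χ : ClassGroup (𝓞 K) →* ℂˣ} (hχ : χ ≠ 1) {f p p' p'' : ℝ → ℝ} {x₀ : ℝ}
    (h : IsSmoothedEFTest f p p' p'' x₀) (hf00 : f 0 = 0) {s : ℂ} (hσ₁ : -(1 / 2) < s.re) :
    Integrable fun y : ℝ ↦ cgEFIntegrand χ f s (((-(1 / 2) : ℝ) : ℂ) + y * I) := by
  obtain ⟨A, hA0, hA⟩ := exists_norm_logDeriv_classGroupLFunction_left_le
  set D := SmoothedEF.decayConst p' p'' x₀ with hD
  have hD0 : 0 ≤ D := SmoothedEF.decayConst_nonneg h.x₀_nonneg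
  set n : ℝ := (Module.finrank ℚ K : ℝ) with hn
  have hn0 : 0 ≤ n := Nat.cast_nonneg _
  have hd0 : 0 ≤ Real.log ((NumberField.discr K).natAbs : ℝ) := Real.log_natCast_nonneg _
  set M : ℝ := A * (n + 1) with hM
  have hM0 : 0 ≤ M := by positivity
  set A₀ : ℝ := Real.log ((NumberField.discr K).natAbs : ℝ) + Real.log 4 with hA₀
  have hA₀0 : 0 ≤ A₀ := by have : 0 ≤ Real.log 4 := Real.log_nonneg (by norm_num); positivity
  set a : ℝ := s.re + 1 / 2 with ha
  have ha0 : 0 < a := by rw [ha]; linarith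
  refine (((SmoothedEF.integrable_left_majorant' (A := A₀) hA₀0 ha0 (t := s.im)).const_mul (M * D))).mono'
    (continuous_cgIntegrand_left hχ h.cont h.x₀_nonneg h.eq_zero hf00 s).aestronglyMeasurable (ae_of_all _ fun y ↦ ?_)
  set w : ℂ := ((-(1 / 2) : ℝ) : ℂ) + y * I with hw
  have hsw_re : (s - w).re = a := by simp [hw, ha]
  have hsw_im : (s - w).im = s.im - y := by simp [hw]
  have hsw : s - w ≠ 0 := fun h0 ↦ by
    have := congrArg Complex.re h0
    rw [hsw_re, Complex.zero_re] at this
    linarith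
  have hnorm : ‖s - w‖ ^ 2 = a ^ 2 + (s.im - y) ^ 2 := by
    rw [Complex.sq_norm, Complex.normSq_apply, hsw_re, hsw_im]; ring
  have hF : ‖fordLaplace₀ f (s - w)‖ ≤ D / (a ^ 2 + (s.im - y) ^ 2) := by
    rw [← hnorm]
    exact SmoothedEF.norm_fordLaplace₀_le h hsw (by rw [hsw_re]; linarith)
  rw [cgEFIntegrand, norm_mul, norm_neg, (classGroupLFunction₀_leftLine_ne_zero hχ y).2]
  have hb := hA K χ y
  have hlog4 : Real.log (|y| + 4) ≤ Real.log 4 + Real.log (1 + |y|) := by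
    rw [← Real.log_mul (by norm_num) (by linarith [abs_nonneg y])]
    exact Real.log_le_log (by linarith [abs_nonneg y]) (by nlinarith [abs_nonneg y])
  have hl1 : 0 ≤ Real.log (1 + |y|) := Real.log_nonneg (by linarith [abs_nonneg y])
  have hb' : ‖logDeriv (classGroupLFunction K χ) (-1 / 2 + y * I)‖ ≤ M * (A₀ + 2 * Real.log (1 + |y|)) := by
    refine hb.trans ?_
    rw [hM, hA₀, ← hn]
    have : Real.log ((NumberField.discr K).natAbs : ℝ) + Real.log (|y| + 4) ≤
        Real.log ((NumberField.discr K).natAbs : ℝ) + Real.log 4 + 2 * Real.log (1 + |y|) := by linarith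
    exact mul_le_mul_of_nonneg_left this (by positivity)
  have hC1 : 0 ≤ M * (A₀ + 2 * Real.log (1 + |y|)) := by positivity
  calc ‖logDeriv (classGroupLFunction K χ) (-1 / 2 + y * I)‖ * ‖fordLaplace₀ f (s - w)‖
      ≤ (M * (A₀ + 2 * Real.log (1 + |y|))) * (D / (a ^ 2 + (s.im - y) ^ 2)) := mul_le_mul hb' hF (norm_nonneg _) hC1
    _ = M * D * ((A₀ + 2 * Real.log (1 + |y|)) / (a ^ 2 + (s.im - y) ^ 2)) := by ring

/-! ## The right line `Re w = 3/2` -/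

/-- On the right line the integrand is that of the prime side:
`∫_ℝ G(3/2 + iv) dv = 2π K_{f,Λ_χ}(s)` and the integrand is integrable (`Re s < 3/2`). [folklore] -/
theorem integral_cgIntegrand_right {χ : ClassGroup (𝓞 K) →* ℂˣ} (hχ : χ ≠ 1) {f p p' p'' : ℝ → ℝ} {x₀ : ℝ}
    (h : IsSmoothedEFTest f p p' p'' x₀) {s : ℂ} (hσ₂ : s.re < 3 / 2) :
    Integrable (fun v : ℝ ↦ cgEFIntegrand χ f s (((3 / 2 : ℝ) : ℂ) + v * I)) ∧
      ∫ v : ℝ, cgEFIntegrand χ f s (((3 / 2 : ℝ) : ℂ) + v * I) = 2 * π * coefFordK (cgCoef χ) f s := by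
  have hα : (1 : ℝ) < 3 / 2 := by norm_num
  have hint : Integrable fun y : ℝ ↦ fordLaplace₀ f ((s.re - 3 / 2 : ℝ) + y * I) :=
    SmoothedEF.integrable_vertical h (by linarith)
  have ha : ∀ n, ‖cgCoef χ n‖ ≤ (Module.finrank ℚ K : ℝ) * Λ n := norm_cgCoef_le χ
  have heq : (fun v : ℝ ↦ cgEFIntegrand χ f s (((3 / 2 : ℝ) : ℂ) + v * I)) = fun v : ℝ ↦
      L (cgCoef χ) (((3 / 2 : ℝ) : ℂ) + v * I) * fordLaplace₀ f (s - ((3 / 2 : ℝ) + v * I)) := by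
    funext v
    have h1 : 1 < ((((3 / 2 : ℝ)) : ℂ) + v * I).re := by simp; norm_num
    rw [cgEFIntegrand, logDeriv_apply, logDeriv_classGroupLFunction₀_eq hχ h1, neg_neg]
  rw [heq]
  exact ⟨integrable_LSeries_coef_mul_fordLaplace₀ ha hα hint,
    integral_LSeries_coef_mul_fordLaplace₀ ha h.cont h.eq_zero hα hσ₂ hint⟩

/-! ## The horizontal sides -/

/-- **The horizontal sides are small**: at a height `T` with `|T| ≥ 2`, the zeros of `L₀(·, χ)`
`η`-separated from `T` and those of `L₀(·, χ⁻¹)` from `−T`, for `|Im s| < |T|` and `Re s > −1/2`: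
`‖∫_{−1/2}^{3/2} G(σ + iT) dσ‖ ≤ (3ℒ'_T/η) · D/(|T| − |Im s|)² · 2`. [folklore] -/
theorem norm_integral_cgIntegrand_horizontal_le {χ : ClassGroup (𝓞 K) →* ℂˣ} (hχ : χ ≠ 1) {f p p' p'' : ℝ → ℝ} {x₀ : ℝ}
    (h : IsSmoothedEFTest f p p' p'' x₀) {s : ℂ} (hσ₁ : -(1 / 2) < s.re) {T η : ℝ} (hT : 2 ≤ |T|) (hsT : |s.im| < |T|)
    (hη : 0 < η) (hη1 : η ≤ 1)
    (hsep : ∀ ρ : ℂ, classGroupLFunction₀ K χ ρ = 0 → 0 < ρ.re → ρ.re < 1 → η ≤ |ρ.im - T|)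
    (hsep' : ∀ ρ : ℂ, classGroupLFunction₀ K χ⁻¹ ρ = 0 → 0 < ρ.re → ρ.re < 1 → η ≤ |ρ.im - -T|) :
    ‖∫ σ : ℝ in (-(1 / 2) : ℝ)..(3 / 2), cgEFIntegrand χ f s (σ + T * I)‖ ≤
      3 * lemmaAHeight K T / η * (SmoothedEF.decayConst p' p'' x₀ / (|T| - |s.im|) ^ 2) * 2 := by
  set D := SmoothedEF.decayConst p' p'' x₀ with hD
  have hD0 : 0 ≤ D := SmoothedEF.decayConst_nonneg h.x₀_nonneg
  have hgap : 0 < |T| - |s.im| := by linarith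
  have hT0 : T ≠ 0 := fun h0 ↦ by rw [h0, abs_zero] at hT; linarith
  have hbound : ∀ σ ∈ Set.uIoc (-(1 / 2) : ℝ) (3 / 2), ‖cgEFIntegrand χ f s (σ + T * I)‖ ≤
      3 * lemmaAHeight K T / η * (D / (|T| - |s.im|) ^ 2) := by
    intro σ hσ
    rw [Set.uIoc_of_le (by norm_num)] at hσ
    set w : ℂ := (σ : ℂ) + T * I with hw
    have hsw_im : (s - w).im = s.im - T := by simp [hw]
    have hsw_re : (s - w).re = s.re - σ := by simp [hw]
    have him : |T| - |s.im| ≤ |(s - w).im| := by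
      rw [hsw_im]
      have := abs_sub_abs_le_abs_sub T s.im
      rw [abs_sub_comm] at this
      linarith
    have hnorm : |T| - |s.im| ≤ ‖s - w‖ := him.trans (Complex.abs_im_le_norm _)
    have hsw : s - w ≠ 0 := norm_pos_iff.1 (hgap.trans_le hnorm)
    have hF : ‖fordLaplace₀ f (s - w)‖ ≤ D / (|T| - |s.im|) ^ 2 := by
      refine (SmoothedEF.norm_fordLaplace₀_le h hsw (by rw [hsw_re]; linarith [hσ.2])).trans ?_
      exact div_le_div_of_nonneg_left hD0 (by positivity) (by gcongr)
    obtain ⟨-, hL⟩ := norm_logDeriv_classGroupLFunction_le_strip hχ hT hη hη1 hsep hsep' hσ.1.le hσ.2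
    have hw1 : w ≠ 1 := fun h0 ↦ by have := congrArg Complex.im h0; simp [hw] at this; exact hT0 this
    rw [← logDeriv_classGroupLFunction₀_eq_logDeriv hχ hw1] at hL
    have hlog : 0 ≤ 3 * lemmaAHeight K T / η := le_trans (norm_nonneg _) hL
    rw [cgEFIntegrand, norm_mul, norm_neg]
    exact mul_le_mul hL hF (norm_nonneg _) hlog
  refine (intervalIntegral.norm_integral_le_of_norm_le_const hbound).trans_eq ?_
  norm_num


/-! ## The zeros in the rectangle: the box of non-trivial zeros and the trivial zero `0` -/

/-- The sum over the zeros of `L₀(·, χ)` in `[−1/2, 3/2] × [−T, T]` splits into the non-trivial zeros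
with `|γ| ≤ T` and the possible trivial zero at `0` (weight `m₀ = ord₀ L₀`, which is `0` when `L₀(0) ≠ 0`).
[folklore] -/
theorem sum_rectZeros_classGroupLFunction₀ {χ : ClassGroup (𝓞 K) →* ℂˣ} (hχ : χ ≠ 1) {T : ℝ} (hT : 0 < T) (g : ℂ → ℂ) :
    ∑ ρ ∈ rectZeros (differentiable_classGroupLFunction₀ χ) (classGroupLFunction₀_two_add_ne_zero hχ 0) (-(1 / 2)) (3 / 2) T,
        (-(analyticOrderNatAt (classGroupLFunction₀ K χ) ρ : ℂ) * g ρ) =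
      ∑ ρ ∈ (finite_nontrivialZeros_inter (differentiable_classGroupLFunction₀ χ)
          (classGroupLFunction₀_two_add_ne_zero hχ 0) T).toFinset,
        (-(analyticOrderNatAt (classGroupLFunction₀ K χ) ρ : ℂ) * g ρ) +
      (-(analyticOrderNatAt (classGroupLFunction₀ K χ) 0 : ℂ) * g 0) := by
  classical
  set f := classGroupLFunction₀ K χ with hf
  have hdf : Differentiable ℂ f := differentiable_classGroupLFunction₀ χ
  have hc : f (2 + ((0 : ℝ) : ℂ) * I) ≠ 0 := classGroupLFunction₀_two_add_ne_zero hχ 0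
  set R := rectZeros hdf hc (-(1 / 2)) (3 / 2) T with hR
  set B := (finite_nontrivialZeros_inter hdf hc T).toFinset with hB
  have hmemB : ∀ ρ, ρ ∈ B ↔ (f ρ = 0 ∧ 0 < ρ.re ∧ ρ.re < 1) ∧ |ρ.im| ≤ T := by
    intro ρ; rw [hB, Set.Finite.mem_toFinset]; rfl
  have h0B : (0 : ℂ) ∉ B := fun h ↦ by
    have := ((hmemB 0).1 h).1.2.1; simp at this
  by_cases h0 : f 0 = 0
  · have hR_eq : R = insert 0 B := by
      ext ρ
      rw [Finset.mem_insert, hmemB, hR, mem_rectZeros]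
      constructor
      · rintro ⟨⟨hre, him⟩, hρ0⟩
        rcases zero_classGroupLFunction₀_cases hχ hρ0 hre.1 hre.2 with ⟨h1, h2⟩ | h
        · exact Or.inr ⟨⟨hρ0, h1, h2⟩, abs_le.2 ⟨him.1, him.2⟩⟩
        · exact Or.inl h
      · rintro (rfl | ⟨⟨hρ0, h1, h2⟩, him⟩)
        · refine ⟨⟨⟨by norm_num, by norm_num⟩, ?_⟩, h0⟩
          simp only [Complex.zero_im, mem_Icc]; exact ⟨by linarith, hT.le⟩
        · exact ⟨⟨⟨by linarith, by linarith⟩, abs_le.1 him⟩, hρ0⟩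
    rw [hR_eq, Finset.sum_insert h0B, add_comm]
  · have hm0 : analyticOrderNatAt f 0 = 0 := by
      have := (hdf.analyticAt 0).analyticOrderAt_eq_zero.2 h0
      rw [analyticOrderNatAt, this]; rfl
    have hR_eq : R = B := by
      ext ρ
      rw [hmemB, hR, mem_rectZeros]
      constructor
      · rintro ⟨⟨hre, him⟩, hρ0⟩
        rcases zero_classGroupLFunction₀_cases hχ hρ0 hre.1 hre.2 with ⟨h1, h2⟩ | h
        · exact ⟨⟨hρ0, h1, h2⟩, abs_le.2 ⟨him.1, him.2⟩⟩
        · exact absurd hρ0 (h ▸ h0)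
      · rintro ⟨⟨hρ0, h1, h2⟩, him⟩
        exact ⟨⟨⟨by linarith, by linarith⟩, abs_le.1 him⟩, hρ0⟩
    rw [hR_eq, hm0]; simp

/-! ## The limit `T → ∞`: the exact explicit formula -/

/-- `discBound K T ≤ (log|d_K| + 4n_K + 1) log(T + 7)` for `T ≥ 0`. [folklore] -/
theorem discBound_le_mul_log (T : ℝ) (hT : 0 ≤ T) :
    discBound K T ≤ (Real.log ((NumberField.discr K).natAbs : ℝ) + 4 * Module.finrank ℚ K + 1) * Real.log (T + 7) := by
  rw [discBound, abs_of_nonneg hT]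
  have hl : 1 ≤ Real.log (T + 7) := by
    rw [Real.le_log_iff_exp_le (by linarith)]; linarith [Real.exp_one_lt_d9]
  have hd : 0 ≤ Real.log ((NumberField.discr K).natAbs : ℝ) := Real.log_natCast_nonneg _
  have hn : (0 : ℝ) ≤ Module.finrank ℚ K := Nat.cast_nonneg _
  nlinarith [mul_nonneg hd (by linarith : (0:ℝ) ≤ Real.log (T + 7) - 1), mul_nonneg hn (by linarith : (0:ℝ) ≤ Real.log (T + 7) - 1)]

set_option maxHeartbeats 800000 in
/-- **The smoothed explicit formula for `L(s, χ)`, `χ ∈ Ĉl_K ∖ {1}`, exact form** (Thorner–Zaman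
Lemma 4.3 for `H = P_K`; Heath-Brown 1992 Lemma 5.1 / Ford 2002 Lemma 4.5 over `K`): for an admissible
smoothing `f` with `f(0) = 0` and `−1/2 < Re s < 3/2`, `s` not a non-trivial zero,
`Σ_n Λ_χ(n) f(log n) n^{−s} = −Σ_ρ m(ρ) F(s − ρ) − m₀ F(s) + J_χ(s)`, `ρ` over the non-trivial zeros
(absolutely convergent), `m₀ = ord₀ L(·, χ)`, `J_χ` the left-line integral (`cgEFRemainder`).
[cite: ThornerZaman2019, Lemma 4.3] -/
theorem coefFordK_eq_explicit {χ : ClassGroup (𝓞 K) →* ℂˣ} (hχ : χ ≠ 1) {f p p' p'' : ℝ → ℝ} {x₀ : ℝ}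
    (h : IsSmoothedEFTest f p p' p'' x₀) (hf00 : f 0 = 0) {s : ℂ} (hσ₁ : -(1 / 2) < s.re) (hσ₂ : s.re < 3 / 2)
    (hsz : ∀ ρ : ℂ, classGroupLFunction₀ K χ ρ = 0 → 0 < ρ.re → ρ.re < 1 → ρ ≠ s) :
    coefFordK (cgCoef χ) f s =
      -(∑' ρ : nontrivialZeros (classGroupLFunction₀ K χ),
          (analyticOrderNatAt (classGroupLFunction₀ K χ) (ρ : ℂ) : ℂ) * fordLaplace₀ f (s - ρ)) -
        (analyticOrderNatAt (classGroupLFunction₀ K χ) 0 : ℂ) * fordLaplace₀ f s + cgEFRemainder χ f s := by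
  have hχ' := inv_ne_one_of_ne_one hχ
  set L0 := classGroupLFunction₀ K χ with hL0
  have hdf : Differentiable ℂ L0 := differentiable_classGroupLFunction₀ χ
  have hc : L0 (2 + ((0 : ℝ) : ℂ) * I) ≠ 0 := classGroupLFunction₀_two_add_ne_zero hχ 0
  have hsum := (summable_norm_cgZeroTerm hχ h (by linarith) hsz).of_norm
  set S := ∑' ρ : nontrivialZeros L0, (analyticOrderNatAt L0 (ρ : ℂ) : ℂ) * fordLaplace₀ f (s - ρ) with hS
  set m₀F : ℂ := (analyticOrderNatAt L0 0 : ℂ) * fordLaplace₀ f s with hm₀F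
  -- good heights `T N ∈ [N, N+1]`
  have hgh : ∀ N : ℕ, ∃ T : ℝ, (N : ℝ) ≤ T ∧ T ≤ N + 1 ∧
      ∀ ρ : ℂ, L0 ρ = 0 → 0 < ρ.re → ρ.re < 1 → (1 / 4104) / discBound K T ≤ |(|ρ.im|) - T| := by
    intro N
    obtain ⟨T, hT, hsepT⟩ := exists_goodHeight_classGroupLFunction₀ hχ (τ₀ := N) (Nat.cast_nonneg N)
    exact ⟨T, hT.1, hT.2, hsepT⟩
  choose T hTN hTN1 hsep using hgh
  have hTtop : Tendsto T atTop atTop := tendsto_atTop_mono hTN tendsto_natCast_atTop_atTop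
  set η : ℕ → ℝ := fun N ↦ min ((1 / 4104) / discBound K (T N)) 1 with hη
  have hT0 : ∀ N, 0 ≤ T N := fun N ↦ (Nat.cast_nonneg N).trans (hTN N)
  have hD1 : ∀ N, 1 ≤ discBound K (T N) := fun N ↦ one_le_discBound K (T N)
  have hη0 : ∀ N, 0 < η N := fun N ↦ lt_min (div_pos (by norm_num) (by linarith [hD1 N])) one_pos
  have hη1 : ∀ N, η N ≤ 1 := fun N ↦ min_le_right _ _
  have hηsep : ∀ N, ∀ ρ : ℂ, L0 ρ = 0 → 0 < ρ.re → ρ.re < 1 → η N ≤ |ρ.im - T N| ∧ η N ≤ |ρ.im + T N| :=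
    fun N ρ h0 h1 h2 ↦ ExplicitPsiChar.dist_of_abs_sub_le (hT0 N) ((min_le_left _ _).trans (hsep N ρ h0 h1 h2))
  -- the same for `χ⁻¹` at `−T N`, by the symmetry of the zeros
  have hηsep' : ∀ N, ∀ ρ : ℂ, classGroupLFunction₀ K χ⁻¹ ρ = 0 → 0 < ρ.re → ρ.re < 1 → η N ≤ |ρ.im - -T N| := by
    intro N ρ h0 h1 h2
    have hs : ∀ n : ℤ, ρ ≠ n := ne_int_of_mem_strip h1 h2
    have h0' : L0 (1 - ρ) = 0 := (classGroupLFunction₀_one_sub_eq_zero_iff hχ hs).2 h0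
    have := (hηsep N (1 - ρ) h0' (by simp; linarith) (by simp; linarith)).1
    simp only [sub_im, one_im, zero_sub] at this
    rwa [show -ρ.im - T N = -(ρ.im - -T N) by ring, abs_neg] at this
  obtain ⟨N₀, hN₀⟩ := exists_nat_gt (2 * |s.im| + 2)
  have hbig : ∀ N : ℕ, max N₀ 2 ≤ N → 2 ≤ N ∧ |s.im| + 1 < T N ∧ (N : ℝ) / 2 ≤ T N - |s.im| := by
    intro N hN
    have hN2 : 2 ≤ N := le_of_max_le_right hN
    have hNN₀ : (N₀ : ℝ) ≤ N := by exact_mod_cast le_of_max_le_left hN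
    have hT := hTN N
    refine ⟨hN2, by linarith [abs_nonneg s.im], by linarith [abs_nonneg s.im]⟩
  -- (1) the truncated zero sums
  have hpart : Tendsto (fun N : ℕ ↦ ∑ ρ ∈ zeroFinset hdf hc (T N),
      (analyticOrderNatAt L0 (ρ : ℂ) : ℂ) * fordLaplace₀ f (s - ρ)) atTop (𝓝 S) :=
    (hsum.hasSum.comp (tendsto_zeroFinset hdf hc)).comp hTtop
  -- (2) the horizontal sides
  set D := SmoothedEF.decayConst p' p'' x₀ with hD
  have hD0 : 0 ≤ D := SmoothedEF.decayConst_nonneg h.x₀_nonneg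
  set B : ℝ := Real.log ((NumberField.discr K).natAbs : ℝ) + 4 * Module.finrank ℚ K + 1 with hB
  have hB1 : 1 ≤ B := by
    have hd : 0 ≤ Real.log ((NumberField.discr K).natAbs : ℝ) := Real.log_natCast_nonneg _
    have hn : (0 : ℝ) ≤ Module.finrank ℚ K := Nat.cast_nonneg _
    rw [hB]; linarith
  set c₁ : ℝ := 77760 * (5 * Module.finrank ℚ K + 2) + 217440 with hc₁
  have hc₁0 : 0 < c₁ := by positivity
  set Mh : ℝ := 3 * c₁ * B * (4105 * B) * (D * 4) * 2 * 4 with hMh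
  have hhor0 : ∀ sgn : ℝ, (sgn = 1 ∨ sgn = -1) →
      Tendsto (fun N : ℕ ↦ ∫ σ : ℝ in (-(1 / 2) : ℝ)..(3 / 2), cgEFIntegrand χ f s (σ + ((sgn * T N : ℝ) : ℂ) * I)) atTop (𝓝 0) := by
    intro sgn hsgn
    refine squeeze_zero_norm' ?_ (by simpa using ((ZetaZeroSum.tendsto_log_sq_div.const_mul Mh)))
    filter_upwards [eventually_ge_atTop (max N₀ 2)] with N hN
    obtain ⟨hN2, hsN, hgapN⟩ := hbig N hN
    have hN2' : (2 : ℝ) ≤ N := by exact_mod_cast hN2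
    have hT2 : 2 ≤ T N := by linarith [hTN N]
    have hTpos : 0 < T N := by linarith
    have hTabs : |sgn * T N| = T N := by
      rcases hsgn with rfl | rfl <;> simp [abs_of_pos hTpos]
    -- separation hypotheses at `sgn * T N`
    have hsepN : ∀ ρ : ℂ, L0 ρ = 0 → 0 < ρ.re → ρ.re < 1 → η N ≤ |ρ.im - sgn * T N| := by
      intro ρ h0 h1 h2
      rcases hsgn with rfl | rfl
      · simpa using (hηsep N ρ h0 h1 h2).1
      · have := (hηsep N ρ h0 h1 h2).2
        rwa [show ρ.im - -1 * T N = ρ.im + T N by ring]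
    have hsepN' : ∀ ρ : ℂ, classGroupLFunction₀ K χ⁻¹ ρ = 0 → 0 < ρ.re → ρ.re < 1 → η N ≤ |ρ.im - -(sgn * T N)| := by
      intro ρ h0 h1 h2
      rcases hsgn with rfl | rfl
      · simpa using hηsep' N ρ h0 h1 h2
      · -- `-(-1 * T) = T`: use the symmetric statement for `χ⁻¹` from `χ`'s `+T` separation
        have hs' : ∀ n : ℤ, ρ ≠ n := ne_int_of_mem_strip h1 h2
        have h0' : L0 (1 - ρ) = 0 := (classGroupLFunction₀_one_sub_eq_zero_iff hχ hs').2 h0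
        have := (hηsep N (1 - ρ) h0' (by simp; linarith) (by simp; linarith)).2
        simp only [sub_im, one_im, zero_sub] at this
        rw [show -ρ.im + T N = -(ρ.im - -(-1 * T N)) by ring, abs_neg] at this
        exact this
    have hbd := norm_integral_cgIntegrand_horizontal_le hχ h hσ₁ (T := sgn * T N) (η := η N)
      (by rw [hTabs]; exact hT2) (by rw [hTabs]; linarith) (hη0 N) (hη1 N) hsepN hsepN'
    rw [hTabs] at hbd
    refine hbd.trans ?_
    -- bookkeeping
    set ℓ := Real.log ((N : ℝ) + 7) with hℓ
    have hℓ1 : 1 ≤ ℓ := by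
      rw [hℓ, Real.le_log_iff_exp_le (by positivity)]; linarith [Real.exp_one_lt_d9]
    have hlogT : Real.log (T N + 7) ≤ 2 * ℓ := by
      calc Real.log (T N + 7) ≤ Real.log (((N : ℝ) + 7) ^ 2) := by
            refine Real.log_le_log (by linarith) ?_; nlinarith [hTN1 N]
        _ = 2 * ℓ := by rw [Real.log_pow, hℓ]; norm_num
    have hDisc : discBound K (T N) ≤ B * (2 * ℓ) := by
      have := discBound_le_mul_log (K := K) (T N) (hT0 N)
      rw [← hB] at this
      exact this.trans (mul_le_mul_of_nonneg_left hlogT (by linarith))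
    have hLAH : lemmaAHeight K (sgn * T N) = c₁ * discBound K (T N) := by
      rw [lemmaAHeight, ← hc₁, show discBound K (sgn * T N) = discBound K (T N) by rw [discBound, discBound, hTabs, abs_of_pos hTpos]]
    have h1η : 1 / η N ≤ 4105 * B * (2 * ℓ) := by
      have hBl : 1 ≤ B * (2 * ℓ) := by nlinarith
      have hηN : η N = min ((1 / 4104) / discBound K (T N)) 1 := rfl
      rw [hηN]
      rcases le_total ((1 / 4104) / discBound K (T N)) 1 with hcase | hcase
      · rw [min_eq_left hcase, one_div_div]
        calc discBound K (T N) / (1 / 4104) = 4104 * discBound K (T N) := by ring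
          _ ≤ 4104 * (B * (2 * ℓ)) := by nlinarith [hDisc]
          _ ≤ 4105 * B * (2 * ℓ) := by nlinarith
      · rw [min_eq_right hcase, div_one]; nlinarith
    have hN0 : (0 : ℝ) < N := by linarith
    have e1 : 3 * lemmaAHeight K (sgn * T N) / η N ≤ 3 * c₁ * B * (4105 * B) * 4 * ℓ ^ 2 := by
      rw [hLAH]
      have e0 : 3 * (c₁ * discBound K (T N)) / η N = 3 * c₁ * discBound K (T N) * (1 / η N) := by ring
      rw [e0]
      have hd0 : 0 ≤ discBound K (T N) := by linarith [hD1 N]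
      calc 3 * c₁ * discBound K (T N) * (1 / η N) ≤ 3 * c₁ * (B * (2 * ℓ)) * (4105 * B * (2 * ℓ)) :=
            mul_le_mul (mul_le_mul_of_nonneg_left hDisc (by positivity)) h1η (by positivity) (by positivity)
        _ = 3 * c₁ * B * (4105 * B) * 4 * ℓ ^ 2 := by ring
    have hsq' : (N : ℝ) / 4 ≤ (T N - |s.im|) ^ 2 := by
      have hsq : ((N : ℝ) / 2) ^ 2 ≤ (T N - |s.im|) ^ 2 := pow_le_pow_left₀ (by positivity) hgapN 2
      nlinarith
    have e2 : D / (T N - |s.im|) ^ 2 ≤ D * 4 / N :=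
      (div_le_div_of_nonneg_left hD0 (by positivity) hsq').trans_eq (by rw [div_div_eq_mul_div])
    calc 3 * lemmaAHeight K (sgn * T N) / η N * (D / (T N - |s.im|) ^ 2) * 2
        ≤ 3 * c₁ * B * (4105 * B) * 4 * ℓ ^ 2 * (D * 4 / N) * 2 :=
          mul_le_mul_of_nonneg_right (mul_le_mul e1 e2 (by positivity) (by positivity)) (by norm_num)
      _ = Mh * (ℓ ^ 2 / N) := by rw [hMh]; ring
  -- (3) the vertical sides
  obtain ⟨hIright, hvalright⟩ := integral_cgIntegrand_right hχ h hσ₂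
  have hright : Tendsto (fun N : ℕ ↦ ∫ y : ℝ in (-T N)..T N, cgEFIntegrand χ f s (((3 / 2 : ℝ) : ℂ) + y * I)) atTop
      (𝓝 (2 * π * coefFordK (cgCoef χ) f s)) := by
    have h3 := intervalIntegral_tendsto_integral hIright (tendsto_neg_atTop_atBot.comp hTtop) hTtop
    rwa [hvalright] at h3
  have hleft : Tendsto (fun N : ℕ ↦ ∫ y : ℝ in (-T N)..T N, cgEFIntegrand χ f s (((-(1 / 2) : ℝ) : ℂ) + y * I)) atTop
      (𝓝 (2 * π * cgEFRemainder χ f s)) := by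
    have h3 := intervalIntegral_tendsto_integral (integrable_cgIntegrand_left hχ h hf00 hσ₁)
      (tendsto_neg_atTop_atBot.comp hTtop) hTtop
    have hval : ∫ y : ℝ, cgEFIntegrand χ f s (((-(1 / 2) : ℝ) : ℂ) + y * I) = 2 * π * cgEFRemainder χ f s := by
      have hπ : (2 * π : ℂ) ≠ 0 := by simp [Real.pi_ne_zero]
      rw [cgEFRemainder, ← mul_assoc, mul_one_div_cancel hπ, one_mul]
    rwa [hval] at h3
  -- (4) the boundary integral along `T N` and its two limits
  have hlim1 : Tendsto (fun N : ℕ ↦ rectBoundaryIntegral (cgEFIntegrand χ f s) (-(1 / 2)) (3 / 2) (-T N) (T N)) atTop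
      (𝓝 (0 - 0 + I * (2 * π * coefFordK (cgCoef χ) f s) - I * (2 * π * cgEFRemainder χ f s))) := by
    have hb := hhor0 (-1) (Or.inr rfl)
    have ht := hhor0 1 (Or.inl rfl)
    simp only [neg_mul, one_mul] at hb ht
    have := ((hb.sub ht).add (hright.const_mul I)).sub (hleft.const_mul I)
    refine this.congr fun N ↦ ?_
    simp only [rectBoundaryIntegral]
  have hgoodN : ∀ N, max N₀ 2 ≤ N → ∀ ρ : ℂ, L0 ρ = 0 → 0 < ρ.re → ρ.re < 1 → ρ.im ≠ T N ∧ ρ.im ≠ -T N := by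
    intro N hN ρ h0 h1 h2
    obtain ⟨ha, hb⟩ := hηsep N ρ h0 h1 h2
    have hη0N := hη0 N
    refine ⟨fun he ↦ ?_, fun he ↦ ?_⟩
    · rw [he, sub_self, abs_zero] at ha; linarith
    · rw [he, neg_add_cancel, abs_zero] at hb; linarith
  have hid : ∀ᶠ N : ℕ in atTop,
      2 * π * I * (-(∑ ρ ∈ zeroFinset hdf hc (T N), (analyticOrderNatAt L0 (ρ : ℂ) : ℂ) * fordLaplace₀ f (s - ρ)) - m₀F) =
        rectBoundaryIntegral (cgEFIntegrand χ f s) (-(1 / 2)) (3 / 2) (-T N) (T N) := by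
    filter_upwards [eventually_ge_atTop (max N₀ 2)] with N hN
    obtain ⟨hN2, hsN, -⟩ := hbig N hN
    have hTpos : 0 < T N := by linarith [abs_nonneg s.im]
    rw [cgEF_contour_identity hχ h.cont h.x₀_nonneg h.eq_zero hf00 s hTpos (hgoodN N hN),
      sum_rectZeros_classGroupLFunction₀ hχ hTpos, ← sum_zeroFinset_eq hdf hc (T N)]
    congr 1
    rw [hm₀F, sub_zero]
    simp only [neg_mul, Finset.sum_neg_distrib]
    ring
  have hlim2 : Tendsto (fun N : ℕ ↦
      2 * π * I * (-(∑ ρ ∈ zeroFinset hdf hc (T N), (analyticOrderNatAt L0 (ρ : ℂ) : ℂ) * fordLaplace₀ f (s - ρ)) - m₀F))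
      atTop (𝓝 (2 * π * I * (-S - m₀F))) :=
    (hpart.neg.sub tendsto_const_nhds).const_mul _
  have heq := tendsto_nhds_unique hlim2 (hlim1.congr' (hid.mono fun N h ↦ h.symm))
  have hπ : (2 * π * I : ℂ) ≠ 0 := by simp [Real.pi_ne_zero]
  have key : 2 * π * I * (coefFordK (cgCoef χ) f s - cgEFRemainder χ f s) = 2 * π * I * (-S - m₀F) := by
    rw [heq]; ring
  have := mul_left_cancel₀ hπ key
  rw [hm₀F] at this
  linear_combination this

end Literature.NumberTheory.LFunctions.NumberField

end
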